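import Mathlib.Order.SupIndep
import HarnessLib
import Literature.NumberTheory.Transcendental.BrownMotivicMZV

/-!
# Crux `HoffmanIndependence` (stmt-KontsevichZagierPeriods-15045), line `Sketch`: `stub_gradingIndep`

For every `M : Brown2012.MotivicMZV` (Brown's motivic multiple zeta values in `𝒰`-coordinates,
a hypothesis bundle) the weight pieces `H_N = M.Hw N` of the algebra `H` form a DIRECT sum: the
family `M.Hw : ℕ → Submodule ℚ M.H` is independent (`iSupIndep`).

Proof (Brown 2012, (2.15) is a morphism of GRADED objects): `φ : H → 𝒰` maps `H_N` into
`𝒰_N = Finsupp.supported ℚ ℚ (uBasis N)` (`φ_mem`) and is injective on `H_N` (`φ_inj`); the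
index sets `uBasis N` are pairwise disjoint (the weight `2 m + ∑ bᵢ` of a monomial
`(m, [b₁, …, b_r])` is a function of the monomial), so `𝒰_i` is disjoint from `⨆_{j ≠ i} 𝒰_j`
(`Finsupp.disjoint_supported_supported`). Hence an `x ∈ H_i ∩ ⨆_{j ≠ i} H_j` has `φ x = 0 = φ 0`,
and `x = 0` by injectivity of `φ` on `H_i`.

Reference: F. Brown, *Mixed Tate motives over ℤ*, Ann. of Math. 175 (2012), (2.15), (2.21)–(2.22).
-/

namespace Summit.KontsevichZagierPeriods.LinRedNormalForm.HoffmanIndependence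

open Literature.NumberTheory.Transcendental MZV Brown2012

/-- The weight pieces `𝒰_j`, `j ≠ i`, of Brown's coalgebra `𝒰` are all supported away from the
weight-`i` monomials: `⨆_{j ≠ i} 𝒰_j ≤ supported (uBasis i)ᶜ` (the weight of a monomial is
well defined). -/
theorem iSup_uWeight_ne_le_supported_compl (i : ℕ) :
    (⨆ (j : ℕ) (_ : j ≠ i), uWeight j) ≤ Finsupp.supported ℚ ℚ (uBasis i)ᶜ :=
  iSup₂_le fun j hj => Finsupp.supported_mono fun p hpj hpi => by
    simp only [uBasis, Set.mem_setOf_eq] at hpj hpi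
    exact hj (hpj.2.symm.trans hpi.2)

/-- The weight pieces of `𝒰` are independent at `i`: `𝒰_i ⊓ ⨆_{j ≠ i} 𝒰_j = 0`. -/
theorem disjoint_uWeight_iSup_ne (i : ℕ) :
    Disjoint (uWeight i) (⨆ (j : ℕ) (_ : j ≠ i), uWeight j) :=
  (Finsupp.disjoint_supported_supported disjoint_compl_right).mono_right
    (iSup_uWeight_ne_le_supported_compl i)

/-- `φ` maps `⨆_{j ≠ i} H_j` into `⨆_{j ≠ i} 𝒰_j` (`φ` is weight-preserving, `φ_mem`). -/
theorem iSup_Hw_ne_le_comap (M : MotivicMZV) (i : ℕ) :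
    (⨆ (j : ℕ) (_ : j ≠ i), M.Hw j) ≤
      Submodule.comap M.φ (⨆ (j : ℕ) (_ : j ≠ i), uWeight j) :=
  iSup₂_le fun j hj y hy => Submodule.mem_comap.mpr
    (Submodule.mem_iSup_of_mem j (Submodule.mem_iSup_of_mem hj (M.φ_mem j y hy)))

/-- **The weight grading of `H` is a direct sum** (Brown 2012, (2.15): `φ : H ↪ 𝒰` is a morphism of
graded objects, injective in each weight). For every `M : MotivicMZV` the family of weight pieces
`M.Hw : ℕ → Submodule ℚ M.H` is independent. -/
theorem stub_gradingIndep : ∀ M : MotivicMZV, iSupIndep M.Hw := by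
  intro M
  refine iSupIndep_def.2 fun i => Submodule.disjoint_def.2 fun x hxi hx' => ?_
  have h1 : M.φ x ∈ uWeight i := M.φ_mem i x hxi
  have h2 : M.φ x ∈ ⨆ (j : ℕ) (_ : j ≠ i), uWeight j := iSup_Hw_ne_le_comap M i hx'
  have h0 : M.φ x = 0 := Submodule.disjoint_def.1 (disjoint_uWeight_iSup_ne i) _ h1 h2
  exact M.φ_inj i hxi (Submodule.zero_mem (M.Hw i)) (h0.trans (map_zero M.φ).symm)

end Summit.KontsevichZagierPeriods.LinRedNormalForm.HoffmanIndependence
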